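import Summits.BirchSwinnertonDyer.BirchSwinnertonDyer.Theorems.GoldfeldAllTwistsTwoConverseTwinGenusSquaresEven
import Summits.BirchSwinnertonDyer.BirchSwinnertonDyer.Theorems.GoldfeldK12AdditiveTwoGenusSquaresOdd
import Mathlib.NumberTheory.LegendreSymbol.QuadraticReciprocity
import HarnessLib

set_option linter.dupNamespace false -- namespace `…BirchSwinnertonDyer.BirchSwinnertonDyer…` is the cell's (D-0017 nested layout)
set_option autoImplicit false

/-!
# GENUS-SQUARES-ODD(−8ℓ): for `d = −8ℓ`, `ℓ ≡ 3 (mod 8)` prime, the squares of the class group `C(−8ℓ)` form a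
# subgroup of ODD order (`C² ∩ C[2] = 1`, «Rédei `4`-rank zero», `h(−8ℓ) ≡ 2 (mod 4)`)

Cell `bsd-goldfeld`, seat `bsd-goldfeld-s1p-c3x` (prover, gen 3); planner g38 RULINGS (cxliv)/(cxlv), ORDER «A‴-F3|ℓ≡3(8)», file K4 of
memo `HOME/F3-ETA-DESCENT.md` §8. Support for item `stmt-BirchSwinnertonDyer-19350` (`BSDTwoCMSplitRankOne`; no claim, no closure),
through THEOREM A‴ on the quarter F3 = `49a1^{(−2ℓ)}`, `ℓ ≡ 3 (mod 8)`: this file SUPPLIES the class-group parity that turns Gross's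
summed conjugation law (ty's FILE D `conjPoint_sum_φ_heegnerTau_sqCoset`, `#S = #Cl²` terms `φ(0) = T`) into the half-trace relations
`Ψ^± + τΨ^± = T` of the torsion branch (sibling K5) — "`#C(𝒪_{−8ℓ})²` is ODD". It is the `ℓ ≡ 3 (mod 8)` twin of seat c3's
GENUS-SQUARES-EVEN (`…TwinGenusSquaresEven.lean`, `ℓ ≡ 7 (mod 8)`, `#C²` EVEN — its docstring already records the present case as
«not formalised here») on the pattern of seat c3's GENUS-SQUARES-ODD (`…GoldfeldK12AdditiveTwoGenusSquaresOdd.lean`, `d = −4q`).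
Theses-free, fact-free: Gauss's genus theory for ONE discriminant on the carrier `ClassGroup (OrderCl.QO Δ)`, `Δ.D = −8ℓ`.

HONEST FRAMING: classical (Gauss §§257–258, 286; Cox §3.B; the `4`-rank statement is Rédei–Reichardt 1934); touches no `L`-value;
proves no case of `BSDTwoCMSplitRankOne` (item 19350 unchanged); F3 is a density-zero prime family; BSD is not proved by any of this.

## The argument (road G: the assigned character `χ_ℓ` by hand)

`D = −8ℓ`, `ℓ ≡ 3 (mod 8)` prime; `C = C(𝒪_D)`, `μ(D) = 2` assigned characters (`D = −4n`, `n = 2ℓ ≡ 2 (mod 4)`), so `#C[2] = 2`.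
The reduced ambiguous form `a = (2, 0, ℓ)` has `[a]² = 1`, `[a] ≠ 1`, so `C[2] = {1, [a]}`. The form `a` represents `a(1,1) = ℓ + 2`,
a unit modulo `8ℓ`; were `[a]` in the principal genus `ker Φ`, `ℓ + 2` would be a value of the principal form `x² + 2ℓy²` modulo `8ℓ`
(Cox Lemma 2.24, tree `mem_ker_genusHom_iff` / `mem_principalValues_iff`), hence modulo `ℓ`: `x² ≡ 2 (mod ℓ)` — impossible for
`ℓ ≡ 3 (mod 8)` by the second supplement (Mathlib `ZMod.exists_sq_eq_two_iff`). So `[a] ∉ ker Φ ⊇ C²`: **`C² ∩ C[2] = 1`** (T1), `#C²` is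
ODD (T2, Cauchy; seat c3's `odd_natCard_of_forall_sq_eq_one` BY NAME), and `h(−8ℓ) = 2·#C² ≡ 2 (mod 4)`. §3 restates T1/T2 over the
field-indexed carrier `ClassGroup (OrderCl.QO hK.negDiscr)`, `d_K = −8ℓ` — the consumer's shape.

References: [Cox2013] D. A. Cox, *Primes of the form x² + ny²*, 2nd ed. (2013), §2.A (2.4), Thm. 2.8; §2.C Lemma 2.24; §3.A Lemma 3.10,
Prop. 3.11; §3.B (3.12), Thm. 3.15; §7.B Thm. 7.7. Sanity: `h(−152) = 6`, `h(−472) = 6`, `h(−664) = 10`, `h(−1048) = 6` (`ℓ = 19, 59, 83, 131`).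
-/

noncomputable section

namespace Summit.BirchSwinnertonDyer.BirchSwinnertonDyer.Theorems.GoldfeldGoodTwists

open Literature.Computability.Cryptography.Hallgren2005
open Literature.Computability.Cryptography.Hallgren2005.OrderCl
open Literature.Computability.Cryptography.Hallgren2005.FormComposition (one one_a isPosPrim_one)
open Literature.NumberTheory.QuadraticFields.Quadratic
open Literature.NumberTheory.QuadraticFields.BinaryQuadraticForm (assignedCharCount classNumber
  assignedCharCount_neg_four_mul_of_mod_four_eq_two)
open Literature.NumberTheory.ComplexMultiplication.CMTypeLattice (finite_classGroup_QO_of_emod_four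
  natCard_classGroup_QO_of_emod_four)
open Literature.NumberTheory.EllipticCurves (IsImaginaryQuadratic)

/-! ## §0 Arithmetic of an odd prime `ℓ`: `ℓ + 2` is a unit modulo `8ℓ` -/

section Arith

variable {l : ℕ}

/-- For an odd prime `ℓ`, `ℓ + 2` is prime to `8ℓ` (odd, and `ℓ ∤ ℓ + 2` as `ℓ > 2`). [folklore] -/
theorem coprime_add_two_eight_mul_of_ne_two (hl : l.Prime) (hl2 : l ≠ 2) : Nat.Coprime (l + 2) (8 * l) := by
  have hodd : Odd l := hl.odd_of_ne_two hl2
  refine Nat.Coprime.mul_right ?_ ?_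
  · have h2 : Nat.Coprime (l + 2) 2 := Nat.coprime_two_right.mpr (by obtain ⟨k, hk⟩ := hodd; exact ⟨k + 1, by omega⟩)
    simpa using h2.pow_right 3
  · refine Nat.Coprime.symm ((Nat.Prime.coprime_iff_not_dvd hl).mpr fun h ↦ ?_)
    have h2 : l ∣ 2 := by simpa using Nat.dvd_sub h (dvd_refl l)
    have := Nat.le_of_dvd (by norm_num) h2
    have := hl.two_le
    omega

end Arith

/-! ## §1 The ambiguous form `a = (2, 0, ℓ)` of discriminant `−8ℓ` (`ℓ ≡ 3 (mod 8)`): `[a]² = 1`, `[a] ≠ 1`, `[a] ∉ ker Φ ⊇ C²` -/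

section Form

variable (Δ : NegDiscr) {l : ℕ}

/-- **`a = (2, 0, ℓ)` is a primitive positive definite form of discriminant `−8ℓ`** (`ℓ ≡ 3 (mod 8)`, so `ℓ` odd:
`0 − 4·2·ℓ = −8ℓ`, `gcd(2, 0, ℓ) = 1`). [cite: Cox2013, §2.A (primitive positive definite forms)] -/
theorem isPosPrim_twoZeroForm_threeModEight (hl8 : l % 8 = 3) (hΔ : Δ.D = -(8 * (l : ℤ))) :
    (⟨2, 0, (l : ℤ)⟩ : BinQF).IsPosPrim Δ.D := by
  refine ⟨?_, by norm_num, ?_⟩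
  · simp only [BinQF.disc, hΔ]
    ring
  · show Nat.gcd (Nat.gcd (2 : ℤ).natAbs (0 : ℤ).natAbs) (l : ℤ).natAbs = 1
    rw [Int.natAbs_natCast]
    exact Nat.coprime_two_left.mpr (Nat.odd_iff.mpr (by omega))

/-- **`a = (2, 0, ℓ)` is reduced** (`|b| = 0 ≤ a = 2 ≤ c = ℓ` for `ℓ ≥ 3`). [cite: Cox2013, §2.A (2.4) (reduced forms)] -/
theorem isReduced_twoZeroForm_threeModEight (hl8 : l % 8 = 3) : (⟨2, 0, (l : ℤ)⟩ : BinQF).IsReduced := by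
  refine ⟨by norm_num, ?_, fun _ ↦ le_rfl⟩
  show (2 : ℤ) ≤ (l : ℤ)
  omega

/-- **`[a]² = 1` in `C(𝒪_{−8ℓ})`** (`a = (2, 0, ℓ)` is reduced and ambiguous, `b = 0`; Cox Lemma 3.10, tree `classOf'_sq_eq_one_iff`).
[cite: Cox2013, §3.A Lemma 3.10] -/
theorem classOf'_twoZeroForm_sq_threeModEight (hl8 : l % 8 = 3) (hΔ : Δ.D = -(8 * (l : ℤ))) :
    classOf' Δ ⟨2, 0, (l : ℤ)⟩ ^ 2 = 1 :=
  (classOf'_sq_eq_one_iff Δ (isPosPrim_twoZeroForm_threeModEight Δ hl8 hΔ)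
    (isReduced_twoZeroForm_threeModEight hl8)).mpr (Or.inl rfl)

/-- **`[a]` is NOT in the principal genus: `[a] ∉ ker Φ`** for Cox's genus homomorphism `Φ = genusHom Δ` (`D = −8ℓ`,
`ℓ ≡ 3 (mod 8)` prime). The form `a` represents `a(1,1) = ℓ + 2`, a unit modulo `8ℓ`; were `[a]` in the principal genus, `ℓ + 2`
would be a value of the principal form `x² + 2ℓy²` modulo `8ℓ` (Cox Lemma 2.24; tree `mem_ker_genusHom_iff` /
`mem_principalValues_iff`), so `x² ≡ 2 (mod ℓ)` — but `2` is a non-residue modulo `ℓ ≡ 3 (mod 8)` (second supplement, Mathlib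
`ZMod.exists_sq_eq_two_iff`). This is the value `χ_ℓ(ℓ + 2) = (2/ℓ) = −1` of the assigned character `χ_ℓ`, by hand.
[cite: Cox2013, §2.C Lemma 2.24 and §3.B (3.12), Thm. 3.15] -/
theorem classOf'_twoZeroForm_notMem_ker_genusHom (hl : l.Prime) (hl8 : l % 8 = 3) (hΔ : Δ.D = -(8 * (l : ℤ))) :
    classOf' Δ ⟨2, 0, (l : ℤ)⟩ ∉ (genusHom Δ).ker := by
  intro hker
  have hl2 : l ≠ 2 := by omega
  have hD0 : Δ.D ≠ 0 := Δ.neg.ne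
  have hn : Δ.D.natAbs = 8 * l := by rw [hΔ, Int.natAbs_neg]; rfl
  -- the unit `u = [ℓ + 2] ∈ (ℤ/8ℓℤ)*`
  have hcop : Nat.Coprime (l + 2) Δ.D.natAbs := by rw [hn]; exact coprime_add_two_eight_mul_of_ne_two hl hl2
  set u : (ZMod Δ.D.natAbs)ˣ := ZMod.unitOfCoprime (l + 2) hcop with hu
  have hcoe : (u : ZMod Δ.D.natAbs) = ((l + 2 : ℕ) : ZMod Δ.D.natAbs) := ZMod.coe_unitOfCoprime _ hcop
  -- `u` is a value of `a`: `a(1, 1) = ℓ + 2`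
  have hval : u ∈ BinQF.valueSet ⟨2, 0, (l : ℤ)⟩ Δ.D := by
    refine (BinQF.mem_valueSet_iff).mpr ⟨1, 1, ?_⟩
    rw [hcoe, show BinQF.eval ⟨2, 0, (l : ℤ)⟩ 1 1 = (((l + 2 : ℕ) : ℤ)) by
      simp only [BinQF.eval]; push_cast; ring, Int.cast_natCast]
  -- in the principal genus, every value of `a` is a value of the principal form `x² + 2ℓ y²`
  rw [(mem_ker_genusHom_iff Δ (isPosPrim_twoZeroForm_threeModEight Δ hl8 hΔ))] at hker
  rw [hker, SetLike.mem_coe, mem_principalValues_iff hD0] at hval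
  obtain ⟨x, y, hxy⟩ := hval
  have hone : FormComposition.one Δ.D = ⟨1, 0, 2 * (l : ℤ)⟩ := by
    rw [one_eq_of_emod_four_eq_zero (D_emod_four_of_eq_neg_eight_mul Δ hΔ), hΔ]
    congr 1
    omega
  rw [hone, hcoe, show BinQF.eval ⟨1, 0, 2 * (l : ℤ)⟩ x y = x ^ 2 + 2 * (l : ℤ) * y ^ 2 by
    simp only [BinQF.eval]; ring] at hxy
  -- reduce modulo `ℓ`: `x² ≡ 2`
  have hdvd : l ∣ Δ.D.natAbs := by rw [hn]; exact dvd_mul_left l 8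
  have h := congrArg (ZMod.castHom hdvd (ZMod l)) hxy
  rw [map_intCast, map_natCast] at h
  push_cast at h
  rw [ZMod.natCast_self] at h
  norm_num at h
  -- so `2` is a square modulo `ℓ`, contradicting `ℓ ≡ 3 (mod 8)`
  haveI := Fact.mk hl
  have hsq : IsSquare (2 : ZMod l) := ⟨(x : ZMod l), by rw [← sq]; exact h.symm⟩
  rcases (ZMod.exists_sq_eq_two_iff hl2).mp hsq with h1 | h7 <;> omega

/-- **`[a]` is not a square in `C(𝒪_{−8ℓ})`** (`C² ⊆ ker Φ`, tree `range_pow_two_le_ker_genusHom`, and `[a] ∉ ker Φ`).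
[cite: Cox2013, §3.B proof of Thm. 3.15] -/
theorem not_isSquare_classOf'_twoZeroForm (hl : l.Prime) (hl8 : l % 8 = 3) (hΔ : Δ.D = -(8 * (l : ℤ))) :
    ¬ IsSquare (classOf' Δ ⟨2, 0, (l : ℤ)⟩) := by
  rintro ⟨r, hr⟩
  refine classOf'_twoZeroForm_notMem_ker_genusHom Δ hl hl8 hΔ (range_pow_two_le_ker_genusHom Δ ⟨r, ?_⟩)
  rw [powMonoidHom_apply, hr, sq]

/-- `[a] ≠ 1` (the unit class is a square). [cite: Cox2013, §3.A Lemma 3.10] -/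
theorem classOf'_twoZeroForm_ne_one_threeModEight (hl : l.Prime) (hl8 : l % 8 = 3) (hΔ : Δ.D = -(8 * (l : ℤ))) :
    classOf' Δ ⟨2, 0, (l : ℤ)⟩ ≠ 1 := fun h ↦
  not_isSquare_classOf'_twoZeroForm Δ hl hl8 hΔ (h ▸ IsSquare.one)

end Form

/-! ## §2 `C(−8ℓ)`, `ℓ ≡ 3 (mod 8)`: `#C[2] = 2`, `C[2] = {1, [a]}`, T1 `C² ∩ C[2] = 1`, T2 `#C²` odd, `h(−8ℓ) ≡ 2 (mod 4)` -/

section ClassGroup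

variable (Δ : NegDiscr) {l : ℕ}

/-- **`μ(−8ℓ) = 2`** assigned characters (`D = −4n`, `n = 2ℓ ≡ 2 (mod 4)`, `ω(n) = 2`; Cox Prop. 3.11), here for `ℓ ≡ 3 (mod 8)`
(seat c3's `assignedCharCount_neg_eight_mul_prime` is the `ℓ ≡ 7 (mod 8)` statement). [cite: Cox2013, §3.A Prop. 3.11] -/
theorem assignedCharCount_neg_eight_mul_prime_threeModEight (hl : l.Prime) (hl8 : l % 8 = 3) (hΔ : Δ.D = -(8 * (l : ℤ))) :
    assignedCharCount Δ.D = 2 := by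
  have h : Δ.D = -4 * ((2 * l : ℕ) : ℤ) := by rw [hΔ]; push_cast; ring
  rw [h, assignedCharCount_neg_four_mul_of_mod_four_eq_two (n := 2 * l) (by omega),
    Nat.primeFactors_mul (by norm_num) hl.ne_zero, Nat.prime_two.primeFactors, hl.primeFactors, ← Finset.insert_eq,
    Finset.card_pair (by omega : 2 ≠ l)]

/-- **`#C(𝒪_{−8ℓ})[2] = 2`** (`2^{μ−1}` with `μ = 2`; tree `natCard_sq_eq_one_classGroup_QO`). [cite: Cox2013, §3.A Prop. 3.11] -/
theorem natCard_sq_eq_one_classGroup_QO_neg_eight_mul (hl : l.Prime) (hl8 : l % 8 = 3) (hΔ : Δ.D = -(8 * (l : ℤ))) :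
    Nat.card {c : ClassGroup (QO Δ) // c ^ 2 = 1} = 2 := by
  rw [natCard_sq_eq_one_classGroup_QO Δ (Or.inl (D_emod_four_of_eq_neg_eight_mul Δ hΔ)),
    assignedCharCount_neg_eight_mul_prime_threeModEight Δ hl hl8 hΔ]
  norm_num

/-- **`C(𝒪_{−8ℓ})[2] = {1, [a]}`**: every class of order `≤ 2` is `1` or the class of `a = (2, 0, ℓ)` (`#C[2] = 2`, `[a]² = 1`,
`[a] ≠ 1`). [cite: Cox2013, §3.A Lemma 3.10 and Prop. 3.11] -/
theorem eq_one_or_eq_classOf'_twoZeroForm_of_sq_eq_one (hl : l.Prime) (hl8 : l % 8 = 3) (hΔ : Δ.D = -(8 * (l : ℤ)))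
    (c : ClassGroup (QO Δ)) (hc : c ^ 2 = 1) : c = 1 ∨ c = classOf' Δ ⟨2, 0, (l : ℤ)⟩ := by
  classical
  by_contra h
  push Not at h
  obtain ⟨hc1, hca⟩ := h
  have h2 := natCard_sq_eq_one_classGroup_QO_neg_eight_mul Δ hl hl8 hΔ
  obtain ⟨y, -, hy⟩ := (Nat.card_eq_two_iff' (⟨1, one_pow 2⟩ : {c : ClassGroup (QO Δ) // c ^ 2 = 1})).mp h2
  have ha : (⟨classOf' Δ ⟨2, 0, (l : ℤ)⟩, classOf'_twoZeroForm_sq_threeModEight Δ hl8 hΔ⟩ :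
      {c : ClassGroup (QO Δ) // c ^ 2 = 1}) = y :=
    hy _ fun e ↦ classOf'_twoZeroForm_ne_one_threeModEight Δ hl hl8 hΔ (congrArg Subtype.val e)
  have hc' : (⟨c, hc⟩ : {c : ClassGroup (QO Δ) // c ^ 2 = 1}) = y := hy _ fun e ↦ hc1 (congrArg Subtype.val e)
  exact hca (congrArg Subtype.val (hc'.trans ha.symm))

/-- **T1 — `C² ∩ C[2] = 1` in `C(𝒪_{−8ℓ})`, `ℓ ≡ 3 (mod 8)` prime («Rédei `4`-rank zero»)**: a square class of order `≤ 2` is trivial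
(`C[2] = {1, [a]}` and `[a]` is not in the principal genus). [cite: Cox2013, §3.B Thm. 3.15 with §3.A Prop. 3.11] -/
theorem eq_one_of_isSquare_of_sq_eq_one_neg_eight_mul (Δ : NegDiscr) (l : ℕ) (hl : l.Prime) (hl8 : l % 8 = 3)
    (hΔ : Δ.D = -(8 * (l : ℤ))) (c : ClassGroup (QO Δ)) (hsq : IsSquare c) (hc : c ^ 2 = 1) : c = 1 := by
  rcases eq_one_or_eq_classOf'_twoZeroForm_of_sq_eq_one Δ hl hl8 hΔ c hc with h | h
  · exact h
  · exact absurd (h ▸ hsq) (not_isSquare_classOf'_twoZeroForm Δ hl hl8 hΔ)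

/-- **T2 (subgroup form) — the subgroup `C²` of squares of `C(𝒪_{−8ℓ})` has ODD order**, `ℓ ≡ 3 (mod 8)` prime (T1 and Cauchy's
theorem, seat c3's `odd_natCard_of_forall_sq_eq_one`). [cite: Cox2013, §3.B Thm. 3.15 with §3.A Prop. 3.11] -/
theorem odd_natCard_range_powMonoidHom_two_classGroup_QO_neg_eight_mul (Δ : NegDiscr) (l : ℕ) (hl : l.Prime)
    (hl8 : l % 8 = 3) (hΔ : Δ.D = -(8 * (l : ℤ))) :
    Odd (Nat.card (powMonoidHom 2 : ClassGroup (QO Δ) →* ClassGroup (QO Δ)).range) := by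
  haveI := finite_classGroup_QO_of_emod_four Δ (Or.inl (D_emod_four_of_eq_neg_eight_mul Δ hΔ))
  refine odd_natCard_of_forall_sq_eq_one fun g hg ↦ Subtype.ext ?_
  obtain ⟨r, hr⟩ := g.2
  refine eq_one_of_isSquare_of_sq_eq_one_neg_eight_mul Δ l hl hl8 hΔ (g : ClassGroup (QO Δ))
    ⟨r, by rw [← hr, powMonoidHom_apply, sq]⟩ ?_
  rw [← Subgroup.coe_pow, hg, Subgroup.coe_one]

/-- **T2 — the number of SQUARE classes of `C(𝒪_{−8ℓ})` is ODD**, `ℓ ≡ 3 (mod 8)` prime. [cite: Cox2013, §3.B Thm. 3.15 with §3.A Prop. 3.11] -/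
theorem odd_natCard_isSquare_classGroup_QO_neg_eight_mul (Δ : NegDiscr) (l : ℕ) (hl : l.Prime) (hl8 : l % 8 = 3)
    (hΔ : Δ.D = -(8 * (l : ℤ))) :
    Odd (Nat.card {c : ClassGroup (QO Δ) // IsSquare c}) := by
  have hmem : ∀ c : ClassGroup (QO Δ),
      c ∈ (powMonoidHom 2 : ClassGroup (QO Δ) →* ClassGroup (QO Δ)).range ↔ IsSquare c := fun c ↦ by
    rw [MonoidHom.mem_range, isSquare_iff_exists_sq]
    exact ⟨fun ⟨x, hx⟩ ↦ ⟨x, hx.symm⟩, fun ⟨x, hx⟩ ↦ ⟨x, hx.symm⟩⟩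
  rw [Nat.card_congr (Equiv.subtypeEquivRight fun c ↦ (hmem c).symm)]
  exact odd_natCard_range_powMonoidHom_two_classGroup_QO_neg_eight_mul Δ l hl hl8 hΔ

/-- **`#C² · 2 = h(−8ℓ)`** for `ℓ ≡ 3 (mod 8)` (`[C : C²] = 2^{μ−1} = 2`, tree `index_range_sq_classGroup_QO`; `#C(𝒪_D) = h(D)`,
`natCard_classGroup_QO_of_emod_four`). [cite: Cox2013, §3.B proof of Thm. 3.15 and §7.B Thm. 7.7 (ii)] -/
theorem natCard_range_powMonoidHom_two_mul_two_eq_classNumber_neg_eight_mul_threeModEight (Δ : NegDiscr) (l : ℕ)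
    (hl : l.Prime) (hl8 : l % 8 = 3) (hΔ : Δ.D = -(8 * (l : ℤ))) :
    Nat.card (powMonoidHom 2 : ClassGroup (QO Δ) →* ClassGroup (QO Δ)).range * 2 = classNumber Δ.D := by
  have hD4 : Δ.D % 4 = 0 ∨ Δ.D % 4 = 1 := Or.inl (D_emod_four_of_eq_neg_eight_mul Δ hΔ)
  haveI := finite_classGroup_QO_of_emod_four Δ hD4
  have hidx := index_range_sq_classGroup_QO Δ hD4
  rw [assignedCharCount_neg_eight_mul_prime_threeModEight Δ hl hl8 hΔ] at hidx
  norm_num at hidx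
  have hcm := Subgroup.card_mul_index (powMonoidHom 2 : ClassGroup (QO Δ) →* ClassGroup (QO Δ)).range
  rw [hidx] at hcm
  rw [← natCard_classGroup_QO_of_emod_four Δ hD4]
  exact hcm

/-- **`h(−8ℓ) ≡ 2 (mod 4)` for `ℓ ≡ 3 (mod 8)` prime** (`h = 2 · #C²` with `#C²` odd), on the bundled carrier.
[cite: Cox2013, §3.B Thm. 3.15 with §3.A Prop. 3.11] -/
theorem classNumber_neg_eight_mul_mod_four_threeModEight (Δ : NegDiscr) (l : ℕ) (hl : l.Prime) (hl8 : l % 8 = 3)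
    (hΔ : Δ.D = -(8 * (l : ℤ))) : classNumber Δ.D % 4 = 2 := by
  obtain ⟨k, hk⟩ := odd_natCard_range_powMonoidHom_two_classGroup_QO_neg_eight_mul Δ l hl hl8 hΔ
  rw [← natCard_range_powMonoidHom_two_mul_two_eq_classNumber_neg_eight_mul_threeModEight Δ l hl hl8 hΔ, hk]
  omega

/-- **`h(−8ℓ) ≡ 2 (mod 4)` for every prime `ℓ ≡ 3 (mod 8)`** (Gauss: `μ = 2` genera, principal genus of odd order).
[cite: Cox2013, §3.B Thm. 3.15 with §3.A Prop. 3.11] -/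
theorem classNumber_neg_eight_mul_prime_mod_four_threeModEight (l : ℕ) (hl : l.Prime) (hl8 : l % 8 = 3) :
    classNumber (-(8 * (l : ℤ))) % 4 = 2 :=
  classNumber_neg_eight_mul_mod_four_threeModEight ⟨-(8 * (l : ℤ)), by have := hl.pos; omega⟩ l hl hl8 rfl

end ClassGroup

/-! ## §3 The consumer's shape: over the carrier `ClassGroup (OrderCl.QO hK.negDiscr)` of an imaginary quadratic field `K`, `d_K = −8ℓ` -/

section Field

variable {l : ℕ} (K : Type*) [Field K] [NumberField K] (hK : IsImaginaryQuadratic K)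

/-- **T1 over the field-indexed carrier**: for `K` imaginary quadratic with `d_K = −8ℓ`, `ℓ ≡ 3 (mod 8)` prime, a square class of
`Cl(𝒪_{d_K}) = ClassGroup (OrderCl.QO hK.negDiscr)` of order `≤ 2` is trivial. [cite: Cox2013, §3.B Thm. 3.15 with §3.A Prop. 3.11] -/
theorem eq_one_of_isSquare_of_sq_eq_one_of_discr_eq_neg_eight_mul (hl : l.Prime) (hl8 : l % 8 = 3)
    (hdK : NumberField.discr K = -(8 * (l : ℤ))) (c : ClassGroup (QO hK.negDiscr)) (hsq : IsSquare c) (hc : c ^ 2 = 1) :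
    c = 1 :=
  eq_one_of_isSquare_of_sq_eq_one_neg_eight_mul hK.negDiscr l hl hl8 (by rw [hK.negDiscr_D, hdK]) c hsq hc

/-- **T2 over the field-indexed carrier (subgroup form)**: `#Cl(𝒪_{d_K})²` is ODD for `d_K = −8ℓ`, `ℓ ≡ 3 (mod 8)` prime — the input
of THEOREM A‴'s half-trace relations (the cosets of `ker χ = Cl²` carry an odd number of terms `φ(0) = T`).
[cite: Cox2013, §3.B Thm. 3.15 with §3.A Prop. 3.11] -/
theorem odd_natCard_range_powMonoidHom_two_of_discr_eq_neg_eight_mul (hl : l.Prime) (hl8 : l % 8 = 3)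
    (hdK : NumberField.discr K = -(8 * (l : ℤ))) :
    Odd (Nat.card (powMonoidHom 2 : ClassGroup (QO hK.negDiscr) →* ClassGroup (QO hK.negDiscr)).range) :=
  odd_natCard_range_powMonoidHom_two_classGroup_QO_neg_eight_mul hK.negDiscr l hl hl8 (by rw [hK.negDiscr_D, hdK])

/-- **T2 over the field-indexed carrier**: the number of square classes of `Cl(𝒪_{d_K})` is odd for `d_K = −8ℓ`, `ℓ ≡ 3 (mod 8)`
prime. [cite: Cox2013, §3.B Thm. 3.15 with §3.A Prop. 3.11] -/
theorem odd_natCard_isSquare_of_discr_eq_neg_eight_mul (hl : l.Prime) (hl8 : l % 8 = 3)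
    (hdK : NumberField.discr K = -(8 * (l : ℤ))) :
    Odd (Nat.card {c : ClassGroup (QO hK.negDiscr) // IsSquare c}) :=
  odd_natCard_isSquare_classGroup_QO_neg_eight_mul hK.negDiscr l hl hl8 (by rw [hK.negDiscr_D, hdK])

/-- **`h(d_K) ≡ 2 (mod 4)`** for `K` imaginary quadratic with `d_K = −8ℓ`, `ℓ ≡ 3 (mod 8)` prime.
[cite: Cox2013, §3.B Thm. 3.15 with §3.A Prop. 3.11] -/
theorem classNumber_discr_mod_four_of_discr_eq_neg_eight_mul_threeModEight (hl : l.Prime) (hl8 : l % 8 = 3)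
    (hdK : NumberField.discr K = -(8 * (l : ℤ))) : classNumber (NumberField.discr K) % 4 = 2 := by
  rw [hdK]
  exact classNumber_neg_eight_mul_prime_mod_four_threeModEight l hl hl8

end Field

end Summit.BirchSwinnertonDyer.BirchSwinnertonDyer.Theorems.GoldfeldGoodTwists

end
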